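import Summits.Ventures.MM22.Rank333.GF2ProfileSymmetry
import HarnessLib

/-!
# ω-census family (a) / cell pub-mm22, v4 (0′)/(0″) glue: profiles as SETS of forms (the 0/1 statement)

Cell `pub-mm22` (MatrixMultiplication venture; HOME `run/shared/lean/pub/pub-mm22/`; seat LIT-2 g9), topic
`Summits/Ventures/MM22`.  HONEST FRAMING: checker PLUMBING, not a result and not a bound.  PROFILE-CERT v1 (§1)
and p1's kernel checker (`ProfileCertSound.lean`, pilot) speak of a profile as a SET `M` of `N` forms
(«0/1 profile»); the tree's glue (`GF2ProfileRows`, `GF2ProfileSymmetry`) speaks of functions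
`prof : Fin N → ℕ` (multisets).  The spec's remark «Why 0/1 and not multisets: every relative-dim-1 row has
N − lb ≤ 1» is made a lemma here: a singleton row `Cert l m n [f] (N − 1)` for each value `f` of a profile
valid against all certified rows forces the profile to be INJECTIVE (`injective_of_validAll`), so its image
`profSet prof` is an `N`-set whose row counts are the profile's (`card_filter_mem_eq`).  Assembly in set form:
`cert_succ_of_noValidSet` — `Cert [] N`, singleton rows `Cert [f] (N − 1)` for every nonzero pattern, and
«no `N`-SET of nonzero patterns `< 2^(l m)` satisfies every certified row» give `Cert [] (N + 1)`.
(For `⟨3,3,3⟩`, `N = 20`: the singleton rows are Wang's dims-8 orbits 492/493 @ 19 and 494 @ 20 ≥ 19,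
transported to each of the 511 forms.)
-/

namespace Summit.Ventures.MM22.GF2Cert.Profile

open Summit.MatrixMultiplication.OmegaCensus.GF2RankLB
open Literature.Computability.AlgebraicComplexity

variable {l m n N : ℕ}

/-- A singleton row bounds the multiplicity of a value: `b + #{i : prof i = f} ≤ N` from `Cert [f] b`. -/
theorem card_filter_eq_le_of_cert_single {prof : Fin N → ℕ} (h : ValidAll l m n N prof) {f b : ℕ}
    (hf : Cert l m n [f] b) : b + (Finset.univ.filter fun i => prof i = f).card ≤ N := by
  have h1 := h [f] b hf
  have he : (Finset.univ.filter fun i => prof i ∈ [f]) = (Finset.univ.filter fun i => prof i = f) := by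
    ext i; simp
  rwa [he] at h1

/-- **0/1**: if every value of the profile has a singleton row with bound `N − 1` (cap `≤ 1`), a profile
valid against all certified rows is injective. -/
theorem injective_of_validAll {prof : Fin N → ℕ} (h : ValidAll l m n N prof)
    (hs : ∀ i, Cert l m n [prof i] (N - 1)) : Function.Injective prof := by
  classical
  intro i j hij
  by_contra hne
  have hcard := card_filter_eq_le_of_cert_single h (hs i)
  have h2 : 2 ≤ (Finset.univ.filter fun k => prof k = prof i).card := by
    have hsub : ({i, j} : Finset (Fin N)) ⊆ Finset.univ.filter fun k => prof k = prof i := by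
      intro k hk
      simp only [Finset.mem_insert, Finset.mem_singleton] at hk
      rcases hk with rfl | rfl <;> simp [hij]
    have := Finset.card_le_card hsub
    rwa [Finset.card_pair hne] at this
  have hpos : 0 < N := Fin.pos i
  omega

/-- The profile as a set of forms. -/
def profSet (prof : Fin N → ℕ) : Finset ℕ := Finset.univ.image prof

/-- An injective `N`-profile is an `N`-set. -/
theorem card_profSet {prof : Fin N → ℕ} (hinj : Function.Injective prof) : (profSet prof).card = N := by
  rw [profSet, Finset.card_image_of_injective _ hinj, Finset.card_univ, Fintype.card_fin]

/-- Row counts of an injective profile are the set's counts: `#{i : prof i ∈ M} = #(profSet ∩ M)`. -/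
theorem card_filter_mem_eq {prof : Fin N → ℕ} (hinj : Function.Injective prof) (M : List ℕ) :
    (Finset.univ.filter fun i => prof i ∈ M).card = ((profSet prof).filter fun f => f ∈ M).card := by
  classical
  rw [profSet, Finset.filter_image, Finset.card_image_of_injective _ hinj]

/-- Members of the set are values of the profile. -/
theorem mem_profSet {prof : Fin N → ℕ} {f : ℕ} : f ∈ profSet prof ↔ ∃ i, prof i = f := by
  simp [profSet]

/-- **Assembly, set form («no valid 0/1 `N`-profile ⇒ `N + 1`»)**: `Cert [] N`, a singleton row
`Cert [f] (N − 1)` for every nonzero pattern `f < 2^(l m)`, and «no `N`-set of nonzero patterns `< 2^(l m)`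
satisfies `b + #(M ∩ K) ≤ N` for every certified row `(K, b)`» give `Cert [] (N + 1)`. -/
theorem cert_succ_of_noValidSet (hN : Cert l m n [] N)
    (hsingle : ∀ f : ℕ, f ≠ 0 → f < 2 ^ (l * m) → Cert l m n [f] (N - 1))
    (hno : ∀ M : Finset ℕ, M.card = N → (∀ f ∈ M, f ≠ 0 ∧ f < 2 ^ (l * m)) →
      (∀ (K : List ℕ) (b : ℕ), Cert l m n K b → b + (M.filter fun f => f ∈ K).card ≤ N) → False) :
    Cert l m n [] (N + 1) := by
  classical
  refine cert_succ_of_noValidAll hN fun prof h0 hlt hV => ?_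
  have hinj : Function.Injective prof :=
    injective_of_validAll hV fun i => hsingle _ (h0 i) (hlt i)
  refine hno (profSet prof) (card_profSet hinj) (fun f hf => ?_) (fun K b hK => ?_)
  · obtain ⟨i, rfl⟩ := mem_profSet.1 hf
    exact ⟨h0 i, hlt i⟩
  · rw [← card_filter_mem_eq hinj K]
    exact hV K b hK

end Summit.Ventures.MM22.GF2Cert.Profile
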